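import Literature.RingTheory.TightClosure.FInjectiveDeformation
import Summits.ResolutionOfSingularities.ResolutionOfSingularities.Theorems.FrobeniusLadderFInjectiveMacaulayficationSliceableCentre
import Summits.ResolutionOfSingularities.ResolutionOfSingularities.Theorems.FrobeniusLadderFInjectiveMacaulayficationExceptionalSlices
import HarnessLib

/-!
# FACT F-90 `CMFIDeforms` HOLDS, and route T-F's kernel is unconditional: #4β ⟸ `SliceableCentreExists` ALONE
# (crux `FInjectiveMacaulayfication` stmt-ResolutionOfSingularities-15315, chain w45a, line T-F under `stub_closedCentreExists`;
# res-L1-w45a-plan-1 RULING R14.1 (2); res-dag-4 FACT F-90 DESK CALL 2026-08-27T16:43:45Z «DISCHARGED-AT-BIRTH»)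

[OURS · L1 W4.5a · res-L1-w45a-stub-1 gen 5] Support file (`--supports stmt-ResolutionOfSingularities-15315 --as helper`); NOT a
statement of any manuscript and replaces the role of nothing in H. Hironaka's text; AI-written (AI review is weaker than expert
review).  FINDING 2026-08-27T16:37:42Z (STATUS): the named fact F-90 `Literature.RingTheory.TightClosure.CMFIDeforms`
(«Cohen–Macaulay + F-injective, in the crux's clause form, deform along a nonzerodivisor»; Fedder 1983 Thm. 3.4 (1) + Matsumura
17.3/17.4 + Quy–Shimomoto 2017 Cor. 3.9; typed statement-only by res-D-pv-036, p548496) is, up to repackaging (`[Fact p.Prime]`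
↦ `p.Prime →`, merged ↦ split clauses), the tree theorem `FInjectiveMacaulayfication.Deformation.cmfi_of_cmfi_quotient`
(`Theorems/…Deformation.lean`, 2026-08-17).  The repackaged clause form is already landed as
`ExceptionalSlices.cmfiDeforms_clause` (res-L1-w45a-stub-3, p549499); this file only NAMES the discharges the desk and the
planner key on:

* `CMFIDeforms_holds : Literature.RingTheory.TightClosure.CMFIDeforms` — F-90 DISCHARGED → THEOREM;
* `sliceableCentre_cmfiDeforms_holds : SliceableCentre.CMFIDeforms` — its OURS textual twin (res-L1-w45a-stub-4, p548504) discharged;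
* `closedCentreExists_of_sliceableCentreExists : SliceableCentre.SliceableCentreExists → SliceableCentre.ClosedCentreExists` —
  route T-F's kernel COR NC `SliceableCentre.closedCentreExists_of_sliceable` with `hFed` discharged: **#4β ⟸ (NC′-∃) alone**.

No definition, no sorry, no new mathematics (three one-liners over landed theorems; the texts are δ-identical). [folklore]
-/

-- single-problem summit: the doubled namespace component is forced
set_option linter.dupNamespace false

namespace Summit.ResolutionOfSingularities.ResolutionOfSingularities.Theorems.FInjectiveMacaulayfication.CMFIDeformsHolds

/-- **FACT F-90 `CMFIDeforms` HOLDS**: for a Noetherian local ring `R` of prime characteristic `p` and a nonzerodivisor `t ∈ 𝔪_R`,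
if `R ⧸ (t)` satisfies the CM clause and the F-clause then so does `R` — by `ExceptionalSlices.cmfiDeforms_clause`, i.e. by the tree
theorem `Deformation.cmfi_of_cmfi_quotient` (Fedder 1983 Thm. 3.4 (1), CM case, in clause form). [cite: Fedder1983, Thm. 3.4 (1)]
[cite: Matsumura1987, Thm. 17.3] [cite: QuyShimomoto2017, Cor. 3.9] -/
theorem CMFIDeforms_holds : Literature.RingTheory.TightClosure.CMFIDeforms :=
  fun p hp R _ _ _ _ t htm ht hCM hF => ExceptionalSlices.cmfiDeforms_clause p hp R t htm ht hCM hF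

/-- **`SliceableCentre.CMFIDeforms` HOLDS** (the Summit-side `@[conjecture] def` of route T-F, text = res-L1-w45a-strat-1 Sig §10‴
`CMFIDeforms` verbatim, = F-90's body with the clause abbreviations `CMCl`/`FCl`): by `ExceptionalSlices.cmfiDeforms_clause`.
[cite: Fedder1983, Thm. 3.4 (1)] -/
theorem sliceableCentre_cmfiDeforms_holds : SliceableCentre.CMFIDeforms :=
  fun p hp R _ _ _ _ t htm ht hCM hF => ExceptionalSlices.cmfiDeforms_clause p hp R t htm ht hCM hF

/-- **COR NC UNCONDITIONAL — #4β ⟸ (NC′-∃) sliceable centres ALONE**: route T-F's kernel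
`SliceableCentre.closedCentreExists_of_sliceable` (res-L1-w45a-strat-1 Sig §10‴, filed by res-L1-w45a-stub-4) with its named-fact
hypothesis `hFed` discharged by `sliceableCentre_cmfiDeforms_holds`. [folklore] -/
theorem closedCentreExists_of_sliceableCentreExists (h : SliceableCentre.SliceableCentreExists) :
    SliceableCentre.ClosedCentreExists :=
  SliceableCentre.closedCentreExists_of_sliceable sliceableCentre_cmfiDeforms_holds h

end Summit.ResolutionOfSingularities.ResolutionOfSingularities.Theorems.FInjectiveMacaulayfication.CMFIDeformsHolds
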